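/-
Copyright: lit-balaban cell, Phase-2 proof seat p11 (gen 2).  Statement-level skeleton of a published paper; no proof claims beyond
what the kernel checks below.
-/
import Literature.MathematicalPhysics.QuantumFieldTheory.BalabanImbrieJaffe1984to88.BIJ85Sect4Statements
import Literature.MathematicalPhysics.QuantumFieldTheory.Balaban1983to89.B1RTSemigroup
import Literature.MathematicalPhysics.QuantumFieldTheory.King1986.EffectiveLaplacianRate

/-!
# `BalabanImbrieJaffe1984to88.BIJ85CoefficientAk464` — T. Bałaban, J. Imbrie, A. Jaffe, *Renormalization of the Higgs model: minimizers,
propagators and the stability of mean field theory*, Commun. Math. Phys. **97** (1985) 299–329 [BalabanImbrieJaffe1985], Sect. 4.6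
p. 313, the sentence between (4.6.3) and (4.6.4): *"The coefficients a_k are produced by iterating one-step renormalization
transformations which use a constant a in the Gaussian. This yields a_k = a(1 − L^{−2})(1 − L^{−2k})^{−1} in the k-step
transformation [3]."* — PROVED by reference to the kernel theorem of [3]: r15's typed `BIJ85Sect4Statements.aK` IS the sequence
`B1.aSeq` of T. Bałaban, *(Higgs)₂,₃ quantum fields in a finite volume I*, CMP **85** (1982) (2.15), for which the composition law
(2.16) is PROVED in `Balaban1983to89.B1RTSemigroup.display216` (seat r14), and King's `King1986.aK`

statement-level skeleton of published theorems with citation tags; proofs where landed; nothing here is a claim about the Yang–Mills mass gap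

PDF held: `paper:balaban1985-cmp97-bij-higgs-minimizers` (journal page = PDF page + 298); p. 313 [PDF 15] read as an image
(`run/shared/lean/pub/lit-balaban/lit-balaban-p08/renders/bij85-p015.png`).

CITATION HEADER (lean-in-tree rule).  Phase-2 file of the lit-balaban TYPED SKELETON (HOME `run/shared/lean/pub/lit-balaban/`), row
**C1.Eq4.6.2-4.6.4** (member: the a_k sentence; decl of record `BIJ85Sect4Statements.aK`, `aK_one`), cross-paper edge C1 → B1.Eq2.15 /
B1.Eq2.16 ("[3]"); seat p11 gen 2 (unit `lit-balaban-p11-g2`), file 3; owner r15, referee ref-5.  THEOREMS ONLY (no definition, no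
`def … : Prop`); nothing of r14's, r15's or the King file is re-declared — the three closed forms are IDENTIFIED (`aK_eq_aSeq`,
`aK_eq_kingAK`), whence for r15's a_k: the one-step recursion (2.13) of [3] `a_{k+1} = aa_k/(aL^{−2} + a_k)` (`aK_succ_eq`), the
composition identity `a_{k+1}^{−1} = a_k^{−1} + L^{−2k}a^{−1}` (`inv_aK_succ_eq`), `0 < a_k ≤ a` (`aK_pos_le`), and **the printed
sentence**: k one-step transformations with the constant a compose to the k-step transformation with the constant a_k
(`kStep_constant_eq_aK` = `B1RTSemigroup.display216` read with `BIJ85Sect4Statements.aK`).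
-/

open MeasureTheory

namespace Literature.MathematicalPhysics.QuantumFieldTheory.BalabanImbrieJaffe1984to88.BIJ85CoefficientAk464

open Literature.MathematicalPhysics.QuantumFieldTheory.Balaban1983to89
open Literature.MathematicalPhysics.QuantumFieldTheory.Balaban1983to89.B1RT
open Literature.MathematicalPhysics.QuantumFieldTheory.Balaban1983to89.B1RTSemigroup

/-- **`a_k` of (4.6.4) IS the sequence (2.15) of [3]** (`B1.aSeq a L k = a(1 − L^{−2})/(1 − L^{−2k})`): the two closed forms agree
for every real `L` and every `k`. [cite: BalabanImbrieJaffe1985, (4.6.4) p.313] -/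
theorem aK_eq_aSeq (a L : ℝ) (k : ℕ) : BIJ85Sect4Statements.aK a L k = B1.aSeq a L k := by
  rw [BIJ85Sect4Statements.aK, B1.aSeq_eq, div_eq_mul_inv, zpow_neg, zpow_neg]
  norm_cast
  rw [inv_pow, ← pow_mul]

/-- `a_k` of (4.6.4) is King's `a_k = a(1 − L⁻²)/(1 − L^{−2k})` (`King1986.aK`, [King1986] (2.13)). [cite: BalabanImbrieJaffe1985, (4.6.4) p.313] -/
theorem aK_eq_kingAK (a L : ℝ) (k : ℕ) : BIJ85Sect4Statements.aK a L k = King1986.aK a L k := by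
  rw [BIJ85Sect4Statements.aK, King1986.aK, div_eq_mul_inv, zpow_neg, zpow_neg]
  norm_cast

/-- *"The coefficients a_k are produced by iterating one-step renormalization transformations which use a constant a"*: the one-step
recursion (2.13) of [3], `a_{k+1} = aa_k/(aL^{−2} + a_k)` (`B1.aSeq_succ`), for r15's `aK` (a > 0, L > 1, k ≥ 1).
[cite: BalabanImbrieJaffe1985, (4.6.4) p.313] -/
theorem aK_succ_eq {a L : ℝ} (ha : 0 < a) (hL : 1 < L) {k : ℕ} (hk : 1 ≤ k) :
    BIJ85Sect4Statements.aK a L (k + 1)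
      = a * BIJ85Sect4Statements.aK a L k / (a * (L ^ 2)⁻¹ + BIJ85Sect4Statements.aK a L k) := by
  rw [aK_eq_aSeq, aK_eq_aSeq]
  exact B1.aSeq_succ ha hL hk

/-- The composition identity `a_{k+1}^{−1} = a_k^{−1} + L^{−2k}a^{−1}` (variances add along the iteration; King's `inv_aK_add` with
`a_1 = a`). [cite: BalabanImbrieJaffe1985, (4.6.4) p.313] -/
theorem inv_aK_succ_eq {a L : ℝ} (ha : 0 < a) (hL : 1 < L) (k : ℕ) :
    (BIJ85Sect4Statements.aK a L (k + 1))⁻¹ = (BIJ85Sect4Statements.aK a L k)⁻¹ + (L ^ (2 * k))⁻¹ * a⁻¹ := by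
  rw [aK_eq_kingAK, aK_eq_kingAK, King1986.inv_aK_add ha hL k 1, King1986.aK_one hL]

/-- `0 < a_k ≤ a` for a > 0, L > 1, k ≥ 1 (a_1 = a and a_k decreases; King's `aK_pos`/`aK_le`). [cite: BalabanImbrieJaffe1985, (4.6.4) p.313] -/
theorem aK_pos_le {a L : ℝ} (ha : 0 < a) (hL : 1 < L) {k : ℕ} (hk : 1 ≤ k) :
    0 < BIJ85Sect4Statements.aK a L k ∧ BIJ85Sect4Statements.aK a L k ≤ a := by
  rw [aK_eq_kingAK]
  exact ⟨King1986.aK_pos ha hL hk, King1986.aK_le ha hL hk⟩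

section KStep

universe u

variable {V : Type*} [NormedAddCommGroup V] [InnerProductSpace ℝ V] [FiniteDimensional ℝ V]
  [MeasurableSpace V] [BorelSpace V]
variable {B : Type u} [Fintype B]

/-- **THE PRINTED SENTENCE, PROVED**: *"This yields a_k = a(1 − L^{−2})(1 − L^{−2k})^{−1} in the k-step transformation [3]"* — on
the tower of lattices of [3] with `|B| = L^d` sites per block, the composition of the k one-step renormalization transformations
with the constant `a` (kernel constants `a(L^jε)^{d−2}`, block weight `L^{−d}`) IS the k-step transformation with the constant
`a_k = BIJ85Sect4Statements.aK a L k` (kernel constant `a_k(L^kε)^{d−2}`) and the composed block average, on every integrable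
density — [3] (2.16) = `B1RTSemigroup.display216` (seat r14) read with r15's `aK`; a, ε > 0, L > 1, k ≥ 1.
[cite: BalabanImbrieJaffe1985, (4.6.4) p.313] -/
theorem kStep_constant_eq_aK {a : ℝ} {L : ℕ} {ε : ℝ} (ha : 0 < a) (hL : 1 < L) (hε : 0 < ε) {d : ℕ}
    (hB : Fintype.card B = L ^ d) {k : ℕ} (hk : 1 ≤ k) (Z : Type u) [Fintype Z]
    (u : (j : ℕ) → Sites B Z j × B → (V ≃ₗᵢ[ℝ] V)) (ρ : (Sites B Z k → V) → ℝ) (hρ : Integrable ρ) :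
    rtChain (((L : ℝ) ^ d)⁻¹) k (precSeq a L ε d k) Z u ρ
      = rtOp (blockKernel (prec (BIJ85Sect4Statements.aK a (L : ℝ) k) ((L : ℝ) ^ k * ε) d)
          (chainAvg (((L : ℝ) ^ d)⁻¹) k Z u)) ρ := by
  rw [aK_eq_aSeq]
  exact display216 ha hL hε hB hk Z u ρ hρ

end KStep

end Literature.MathematicalPhysics.QuantumFieldTheory.BalabanImbrieJaffe1984to88.BIJ85CoefficientAk464
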